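import Summits.CriticalPhenomena.CardyFormulaZ2.Theorems.CardyIKTransportIKQuarterTurnBijection
import Literature.Probability.Percolation.LatticeSymmetry

/-!
# `IKQuarterTurn` (route `CardyIKTransport`, stmt-CriticalPhenomena-10900): the exact quarter-turn
# symmetry of the isotropic Izergin–Korepin gauge

The support item `CardyIKTransport.IKQuarterTurn` (typed hypothesis (a) of `AnchorByRigidity` for the
explicit i.i.d.-bit gauge `P_IK` of the isotropic Izergin–Korepin point): for every conformal rectangle
`R` and every `L`, `P_IK (I • R) δ → L` iff `P_IK R δ → L` as `δ → 0⁺`. We prove the finite-`δ`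
identity `P_IK (I • R) δ = P_IK R δ` (`mixedCrossingProb_univ_quarterTurn`, through the vocabulary of
`Theorems/CardyIKTransportIKLinearTransportLine.lean` and its `mixedCrossingProb_univ : _ = P_IK R`) and
deduce the item (`IKQuarterTurn_proof`).

THE PROOF. Part 1 (`Theorems/CardyIKTransportIKQuarterTurnBijection.lean`) constructs a bijection
`Φ : Ω ≃ᵐ Ω` of the bit space preserving the gauge law `μIK` and carrying the black cells to their image
under the quarter-turn `rot v = (-v₁, v₀)` of `ℤ²` and the anti-diagonal faces to the complement of their
`faceRot`-image. Here: (§1) the open edge set (nearest-neighbour black pairs and black diagonals of the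
chosen type) is then carried to its `rot`-image (`blackEdges_rot`: horizontal ↔ vertical bonds, main ↔ anti
diagonals); (§2) the crude crossing event `embDomainCrossing` of `I • R` pulls back along `rot` to that of
`R`, because `sqEmb ∘ rot = I • sqEmb` and `z ↦ I z` is an isometry (`embDomainCrossing_quarterTurn`,
via the tree's `preimage_relabel_openCrossing`, `MarkedDomain.carrier_map` / `arc_map`,
`Metric.infDist_image`); (§3) hence `P_IK (I • R) δ = μIK (Φ ⁻¹' E_{I•R}) = μIK E_R = P_IK R δ`
(`MeasurableEquiv.map_apply`, no measurability of the crossing event needed). Elementary; no literature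
fact is used (route file `Theses/CardyIKTransport.lean`, item 10900).
-/

noncomputable section

namespace Summit.CriticalPhenomena.CardyFormulaZ2.Theorems.IKQuarterTurn

open MeasureTheory Filter Topology Set
open Literature.Probability.Percolation Literature.Probability.LatticeModels
open Literature.Probability.RandomPlanarGeometry
open Summit.CriticalPhenomena.CardyFormulaZ2.Theorems.IKLinearTransport
open Summit.CriticalPhenomena.CardyFormulaZ2.Theorems.IKLinearTransport.PinnedDiagramExchange

/-! ## §1 The open edge set is rotated -/

/-- THE OPEN EDGE SET IS ROTATED: with rotated black cells and rotated-and-flipped diagonals, the open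
edges (nearest-neighbour black pairs and black diagonals of the chosen type) are the `rot`-images of the
original ones (horizontal ↔ vertical, main ↔ anti diagonal). [folklore] -/
theorem blackEdges_rot (X Y : Set (Site 2)) :
    blackEdges (rot.symm ⁻¹' X, (faceRot.symm ⁻¹' Y)ᶜ) =
      BondConfig.relabel (sym2Equiv rot) (blackEdges (X, Y)) := by
  ext e
  rw [BondConfig.mem_relabel_iff, sym2Equiv_symm]
  constructor
  · rintro ⟨u, v, rfl, hu, hv, h⟩
    rw [sym2Equiv_mk]
    simp only [mem_preimage, mem_compl_iff, not_not] at hu hv h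
    rcases h with h | h | ⟨h, hA⟩ | ⟨h, hA⟩
    · refine ⟨rot.symm v, rot.symm u, Sym2.eq_swap, hv, hu, Or.inr (Or.inl ?_)⟩
      rw [h]
      ext i; fin_cases i <;>
        simp only [Fin.zero_eta, Fin.mk_one, Pi.add_apply, rot_symm_apply_zero, rot_symm_apply_one,
          Matrix.cons_val_zero, Matrix.cons_val_one]
      all_goals omega
    · refine ⟨rot.symm u, rot.symm v, rfl, hu, hv, Or.inl ?_⟩
      rw [h]
      ext i; fin_cases i <;>
        simp only [Fin.zero_eta, Fin.mk_one, Pi.add_apply, rot_symm_apply_zero, rot_symm_apply_one,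
          Matrix.cons_val_zero, Matrix.cons_val_one]
      all_goals omega
    · refine ⟨rot.symm u, rot.symm v, rfl, hu, hv, Or.inr (Or.inr (Or.inr ⟨?_, ?_⟩))⟩
      · rw [h]
        ext i; fin_cases i <;>
          simp only [Fin.zero_eta, Fin.mk_one, Pi.add_apply, rot_symm_apply_zero, rot_symm_apply_one,
            Matrix.cons_val_zero, Matrix.cons_val_one]
        all_goals omega
      · have hf : rot.symm u + ![0, -1] = faceRot.symm u := by
          ext i; fin_cases i <;>
            simp only [Fin.zero_eta, Fin.mk_one, Pi.add_apply, rot_symm_apply_zero, rot_symm_apply_one, faceRot_symm_apply_zero, faceRot_symm_apply_one,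
              Matrix.cons_val_zero, Matrix.cons_val_one]
          all_goals omega
        rw [hf]; exact hA
    · refine ⟨rot.symm v, rot.symm u, Sym2.eq_swap, hv, hu, Or.inr (Or.inr (Or.inl ⟨?_, ?_⟩))⟩
      · rw [h]
        ext i; fin_cases i <;>
          simp only [Fin.zero_eta, Fin.mk_one, Pi.add_apply, rot_symm_apply_zero, rot_symm_apply_one,
            Matrix.cons_val_zero, Matrix.cons_val_one]
        all_goals omega
      · have hf : rot.symm v = faceRot.symm (u + ![0, -1]) := by
          rw [h]
          ext i; fin_cases i <;>
            simp only [Fin.zero_eta, Fin.mk_one, Pi.add_apply, rot_symm_apply_zero, rot_symm_apply_one, faceRot_symm_apply_zero, faceRot_symm_apply_one,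
              Matrix.cons_val_zero, Matrix.cons_val_one]
          all_goals omega
        rw [hf]; exact hA
  · rintro ⟨u, v, he, hu, hv, h⟩
    have he' : e = s(rot u, rot v) := by
      rw [← (sym2Equiv rot).apply_symm_apply e, sym2Equiv_symm, he]; rfl
    rw [he']
    dsimp only at hu hv h
    have hu' : rot u ∈ rot.symm ⁻¹' X := by rw [mem_preimage, Equiv.symm_apply_apply]; exact hu
    have hv' : rot v ∈ rot.symm ⁻¹' X := by rw [mem_preimage, Equiv.symm_apply_apply]; exact hv
    rcases h with h | h | ⟨h, hA⟩ | ⟨h, hA⟩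
    · refine ⟨rot u, rot v, rfl, hu', hv', Or.inr (Or.inl ?_)⟩
      rw [h]
      ext i; fin_cases i <;>
        simp only [Fin.zero_eta, Fin.mk_one, Pi.add_apply, rot_apply_zero, rot_apply_one,
          Matrix.cons_val_zero, Matrix.cons_val_one]
      all_goals omega
    · refine ⟨rot v, rot u, Sym2.eq_swap, hv', hu', Or.inl ?_⟩
      rw [h]
      ext i; fin_cases i <;>
        simp only [Fin.zero_eta, Fin.mk_one, Pi.add_apply, rot_apply_zero, rot_apply_one,
          Matrix.cons_val_zero, Matrix.cons_val_one]
      all_goals omega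
    · refine ⟨rot v, rot u, Sym2.eq_swap, hv', hu', Or.inr (Or.inr (Or.inr ⟨?_, ?_⟩))⟩
      · rw [h]
        ext i; fin_cases i <;>
          simp only [Fin.zero_eta, Fin.mk_one, Pi.add_apply, rot_apply_zero, rot_apply_one,
            Matrix.cons_val_zero, Matrix.cons_val_one]
        all_goals omega
      · have hf : faceRot.symm (rot v + ![0, -1]) = u := by
          rw [h]
          ext i; fin_cases i <;>
            simp only [Fin.zero_eta, Fin.mk_one, Pi.add_apply, rot_apply_zero, rot_apply_one, faceRot_symm_apply_zero, faceRot_symm_apply_one,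
              Matrix.cons_val_zero, Matrix.cons_val_one]
          all_goals omega
        show rot v + ![0, -1] ∈ (faceRot.symm ⁻¹' Y)ᶜ
        rw [mem_compl_iff, mem_preimage, hf]; exact hA
    · refine ⟨rot u, rot v, rfl, hu', hv', Or.inr (Or.inr (Or.inl ⟨?_, ?_⟩))⟩
      · rw [h]
        ext i; fin_cases i <;>
          simp only [Fin.zero_eta, Fin.mk_one, Pi.add_apply, rot_apply_zero, rot_apply_one,
            Matrix.cons_val_zero, Matrix.cons_val_one]
        all_goals omega
      · have hf : faceRot.symm (rot u) = u + ![0, -1] := by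
          ext i; fin_cases i <;>
            simp only [Fin.zero_eta, Fin.mk_one, Pi.add_apply, rot_apply_zero, rot_apply_one, faceRot_symm_apply_zero, faceRot_symm_apply_one,
              Matrix.cons_val_zero, Matrix.cons_val_one]
          all_goals omega
        show ¬ rot u ∈ (faceRot.symm ⁻¹' Y)ᶜ
        rw [mem_compl_iff, mem_preimage, hf, not_not]; exact hA

/-- The open edge set after `Φ` is the `rot`-image of the open edge set. [folklore] -/
theorem blackEdges_obs_Φ (ω : Ω) :
    blackEdges (obs Set.univ (Φ ω)) = BondConfig.relabel (sym2Equiv rot) (blackEdges (obs Set.univ ω)) := by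
  rw [obs_Φ, blackEdges_rot]; rfl

/-! ## §2 The crude crossing event of `I • R` pulls back to that of `R` -/

/-- The square embedding intertwines `rot⁻¹` with multiplication by `-I`. [folklore] -/
theorem sqEmb_rot_symm (v : Site 2) : sqEmb (rot.symm v) = -Complex.I * sqEmb v := by
  simp only [sqEmb, rot_symm_apply_zero, rot_symm_apply_one, Int.cast_neg, Complex.ofReal_neg]
  linear_combination (((v 1 : ℤ) : ℝ) : ℂ) * Complex.I_sq

/-- Multiplication by `I` is an isometry of `ℂ`. [folklore] -/
theorem isometry_mul_I : Isometry fun z : ℂ => Complex.I * z :=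
  Isometry.of_dist_eq fun x y => by
    rw [Complex.dist_eq, Complex.dist_eq, ← mul_sub, norm_mul, Complex.norm_I, one_mul]

/-- Cells whose rescaled position lies in `I • Ω` are the `rot`-images of those for `Ω`. [folklore] -/
theorem cells_in_quarterTurn (Ωc : Set ℂ) (δ : ℝ) :
    {y : Site 2 | (δ : ℂ) * sqEmb y ∈ (Homeomorph.mulLeft₀ Complex.I Complex.I_ne_zero) '' Ωc} =
      rot '' {y : Site 2 | (δ : ℂ) * sqEmb y ∈ Ωc} := by
  ext y
  rw [Equiv.image_eq_preimage_symm, Homeomorph.image_eq_preimage_symm]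
  simp only [mem_setOf_eq, mem_preimage, Homeomorph.mulLeft₀_symm_apply, sqEmb_rot_symm]
  rw [show (Complex.I)⁻¹ * ((δ : ℂ) * sqEmb y) = (δ : ℂ) * (-Complex.I * sqEmb y) by
    rw [Complex.inv_I]; ring]

/-- Cells within rescaled distance `2δ` of `I • A` are the `rot`-images of those for `A`. [folklore] -/
theorem cells_near_quarterTurn (A : Set ℂ) (δ : ℝ) :
    {u : Site 2 | Metric.infDist ((δ : ℂ) * sqEmb u) ((Homeomorph.mulLeft₀ Complex.I Complex.I_ne_zero) '' A)
        ≤ 2 * δ} =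
      rot '' {u : Site 2 | Metric.infDist ((δ : ℂ) * sqEmb u) A ≤ 2 * δ} := by
  ext u
  rw [Equiv.image_eq_preimage_symm]
  simp only [mem_setOf_eq, mem_preimage, Homeomorph.coe_mulLeft₀]
  have h : (δ : ℂ) * sqEmb u = Complex.I * ((δ : ℂ) * sqEmb (rot.symm u)) := by
    rw [sqEmb_rot_symm]
    linear_combination ((δ : ℂ) * sqEmb u) * Complex.I_sq
  rw [h, show Metric.infDist (Complex.I * ((δ : ℂ) * sqEmb (rot.symm u))) ((fun z : ℂ => Complex.I * z) '' A) =
      Metric.infDist ((δ : ℂ) * sqEmb (rot.symm u)) A from Metric.infDist_image isometry_mul_I]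

/-- THE CRUDE CROSSING EVENT OF `I • R` PULLS BACK ALONG `rot` TO THAT OF `R` (covariance of
`embDomainCrossing` under the isometry `z ↦ I z`, `sqEmb ∘ rot = I • sqEmb`). [folklore] -/
theorem embDomainCrossing_quarterTurn (Ωc A B : Set ℂ) (δ : ℝ) :
    BondConfig.relabel (sym2Equiv rot) ⁻¹'
        embDomainCrossing sqEmb ((Homeomorph.mulLeft₀ Complex.I Complex.I_ne_zero) '' Ωc) δ
          ((Homeomorph.mulLeft₀ Complex.I Complex.I_ne_zero) '' A)
          ((Homeomorph.mulLeft₀ Complex.I Complex.I_ne_zero) '' B) =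
      embDomainCrossing sqEmb Ωc δ A B := by
  unfold embDomainCrossing
  rw [cells_in_quarterTurn, cells_near_quarterTurn, cells_near_quarterTurn, preimage_relabel_openCrossing]

/-! ## §3 The finite-`δ` identity and the item -/

/-- The crossing event of `I • R` pulls back along `Φ` to the crossing event of `R`. [folklore] -/
theorem preimage_Φ_crossingEvent (R : ConformalRectangle) (δ : ℝ) :
    Φ ⁻¹' {ω | blackEdges (obs Set.univ ω) ∈
        embDomainCrossing sqEmb ((Homeomorph.mulLeft₀ Complex.I Complex.I_ne_zero) '' R.carrier) δ
          ((Homeomorph.mulLeft₀ Complex.I Complex.I_ne_zero) '' R.arc 0)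
          ((Homeomorph.mulLeft₀ Complex.I Complex.I_ne_zero) '' R.arc 2)} =
      {ω | blackEdges (obs Set.univ ω) ∈ embDomainCrossing sqEmb R.carrier δ (R.arc 0) (R.arc 2)} := by
  ext ω
  simp only [mem_preimage, mem_setOf_eq]
  rw [blackEdges_obs_Φ, ← embDomainCrossing_quarterTurn R.carrier (R.arc 0) (R.arc 2) δ, mem_preimage]

/-- THE FINITE-`δ` IDENTITY: the crude IK crossing probability of the quarter-turned rectangle equals
that of the rectangle, `P_IK (I • R) δ = P_IK R δ`. [folklore] -/
theorem mixedCrossingProb_univ_quarterTurn (R : ConformalRectangle) (δ : ℝ) :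
    mixedCrossingProb Set.univ (R.map (Homeomorph.mulLeft₀ Complex.I Complex.I_ne_zero)) δ =
      mixedCrossingProb Set.univ R δ := by
  unfold mixedCrossingProb
  rw [MarkedDomain.carrier_map, MarkedDomain.arc_map, MarkedDomain.arc_map,
    ← preimage_Φ_crossingEvent R δ, measureReal_def, measureReal_def, ← MeasurableEquiv.map_apply Φ,
    measurePreserving_Φ.map_eq]

/-- The same identity for the crux's verbatim family `P_IK` (`Negative.Pik`). [folklore] -/
theorem Pik_quarterTurn (R : ConformalRectangle) :
    Negative.Pik (R.map (Homeomorph.mulLeft₀ Complex.I Complex.I_ne_zero)) = Negative.Pik R := by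
  funext δ
  rw [← mixedCrossingProb_univ, ← mixedCrossingProb_univ, mixedCrossingProb_univ_quarterTurn]

/-- **Item stmt-CriticalPhenomena-10900 (`IKQuarterTurn`), proved**: the crossing probabilities of the
isotropic Izergin–Korepin gauge in a conformal rectangle and in its quarter-turn have the same limits as
`δ → 0⁺` — indeed they are equal for every `δ`. [folklore] -/
theorem IKQuarterTurn_proof :
    Summit.CriticalPhenomena.CardyFormulaZ2.Theses.CardyIKTransport.IKQuarterTurn := by
  unfold Summit.CriticalPhenomena.CardyFormulaZ2.Theses.CardyIKTransport.IKQuarterTurn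
  intro P R L
  change Tendsto (Negative.Pik (R.map (Homeomorph.mulLeft₀ Complex.I Complex.I_ne_zero))) _ _ ↔
    Tendsto (Negative.Pik R) _ _
  rw [Pik_quarterTurn]
end Summit.CriticalPhenomena.CardyFormulaZ2.Theorems.IKQuarterTurn

end
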